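import Summits.Ventures.CertifiedManyBodySolver.Theorems.TcThermcert1QbpSeamLeakage
import Mathlib
import HarnessLib

/-!
# `TcThermcert1` — QBP chain, PART 7e: level functions and the closed-form leakage bound

The last model-specific input of hypothesis `hε` of PART 6 for stub B of the line `gauge_qbp_far_seam`: on the
`L × L` torus measure sites by the circular distance `d(x) = |x₁|_∘` of their first coordinate to the seam column
(`ZMod.valMinAbs`), keep the Hubbard terms supported in the collar `X_r = {d ≤ r}` (`T_r`), and use the levels
`δ_Z(x) = max_{z ∈ supp Z} (d(z) − d(x) − 1)₊` (vanishing on `supp Z`, `1`-Lipschitz along torus edges).  Then every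
hypothesis of `norm_seamDynamics_sub_collar_le` (PART 7d) is discharged with `m = r − 2` (`r ≥ 2`), giving the
closed form
`‖τ^{H + sV}_t(V) − τ^{H_{T_r} + sV}_t(V)‖ ≤ N · 2‖V‖ · N · 2J²|t| e^{44eJ|t| − (r − 2)} · |t|`,
`H = hubbardTorusTT'Flux L 0 U 0`, `V = seamTwist L θ`, `J = 2 + |U| + 2|θ|`, `N = |HubbardIdx ⊕ (ZMod L × Fin 2)|`,
for all `s ∈ [0, 1]`, `t`, `r ≥ 2` — exponentially small for `|t| ≤ T` once `r − 2 ≫ 44eJT`.  (With `‖V‖ ≤ 4L|θ|`,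
`N = O(L²)`, `r ≍ L/4`, `T ≍ r/(88eJ)` this is the `ε_L = poly(L) e^{−κL}` of the line card.)
Sources: Hastings–Koma 2006 App. A; Capel–Moscolari–Teufel–Wessel, arXiv:2310.09182, Thm. 14 (input (ii)).
SC in the Hubbard model is NOT proved by anything here.
-/

noncomputable section

open Matrix Finset
open scoped Matrix.Norms.L2Operator
open Literature.MathematicalPhysics.QuantumLattice
open Literature.Probability.LatticeModels

namespace Summit.Ventures.CertifiedManyBodySolver.Theorems.TcThermcert1.GaugeQbpFarSeam

/-! ### §1 The circular distance on `ZMod L` -/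

section Circular

variable (L : ℕ) [NeZero L]

/-- `|1|_∘ ≤ 1` on `ZMod L`. [folklore] -/
theorem natAbs_valMinAbs_one_le : (1 : ZMod L).valMinAbs.natAbs ≤ 1 := by
  rw [ZMod.valMinAbs_natAbs_eq_min, ZMod.val_one_eq_one_mod]
  exact (min_le_left _ _).trans (Nat.mod_le 1 L)

/-- `|-1|_∘ ≤ 1` on `ZMod L`. [folklore] -/
theorem natAbs_valMinAbs_neg_one_le : (-1 : ZMod L).valMinAbs.natAbs ≤ 1 := by
  rw [ZMod.natAbs_valMinAbs_neg]
  exact natAbs_valMinAbs_one_le L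

/-- `|a + 1|_∘ ≤ |a|_∘ + 1`. [folklore] -/
theorem natAbs_valMinAbs_add_one_le (a : ZMod L) :
    (a + 1).valMinAbs.natAbs ≤ a.valMinAbs.natAbs + 1 :=
  ((ZMod.natAbs_valMinAbs_add_le a 1).trans (Int.natAbs_add_le _ _)).trans
    (by have := natAbs_valMinAbs_one_le L; omega)

/-- `|a|_∘ ≤ |a + 1|_∘ + 1`. [folklore] -/
theorem natAbs_valMinAbs_le_add_one (a : ZMod L) :
    a.valMinAbs.natAbs ≤ (a + 1).valMinAbs.natAbs + 1 := by
  have h := (ZMod.natAbs_valMinAbs_add_le (a + 1) (-1)).trans (Int.natAbs_add_le _ _)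
  rw [add_neg_cancel_right] at h
  exact h.trans (by have := natAbs_valMinAbs_neg_one_le L; omega)

end Circular

/-! ### §2 The first coordinate along torus edges -/

section Coordinate

variable (L : ℕ) [NeZero L]

/-- Along an edge of the `L × L` torus the circular size of the first coordinate changes by at most one.
[folklore] -/
theorem natAbs_valMinAbs_fst_le_of_adj {x y : FermionTorus 2 L} (h : (fermionTorusGraph 2 L).Adj x y) :
    (FermionTorus.toTorusSite x 0).valMinAbs.natAbs ≤ (FermionTorus.toTorusSite y 0).valMinAbs.natAbs + 1 := by
  rw [fermionTorusGraph_adj, torusGraph_adj_iff] at h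
  obtain ⟨-, ⟨i, hi⟩ | ⟨i, hi⟩⟩ := h
  · have h0 : FermionTorus.toTorusSite y 0 = FermionTorus.toTorusSite x 0 + (Pi.single i 1 : TorusSite 2 L) 0 := by
      rw [hi, Pi.add_apply]
    by_cases hi0 : i = 0
    · subst hi0
      rw [Pi.single_eq_same] at h0
      rw [h0]
      exact natAbs_valMinAbs_le_add_one L _
    · rw [Pi.single_eq_of_ne (Ne.symm hi0), add_zero] at h0
      rw [h0]
      exact Nat.le_succ _
  · have h0 : FermionTorus.toTorusSite x 0 = FermionTorus.toTorusSite y 0 + (Pi.single i 1 : TorusSite 2 L) 0 := by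
      rw [hi, Pi.add_apply]
    by_cases hi0 : i = 0
    · subst hi0
      rw [Pi.single_eq_same] at h0
      rw [h0]
      exact natAbs_valMinAbs_add_one_le L _
    · rw [Pi.single_eq_of_ne (Ne.symm hi0), add_zero] at h0
      rw [h0]
      exact Nat.le_succ _

/-- The same for two sites that coincide or are adjacent (the shape of a support of diameter `≤ 1`). [folklore] -/
theorem natAbs_valMinAbs_fst_le_of_eq_or_adj {x y : FermionTorus 2 L} (h : x = y ∨ (fermionTorusGraph 2 L).Adj x y) :
    (FermionTorus.toTorusSite x 0).valMinAbs.natAbs ≤ (FermionTorus.toTorusSite y 0).valMinAbs.natAbs + 1 := by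
  rcases h with rfl | h
  · exact Nat.le_succ _
  · exact natAbs_valMinAbs_fst_le_of_adj L h

/-- The seam columns `x₁ ∈ {0, -1}` have circular size `≤ 1`. [folklore] -/
theorem natAbs_valMinAbs_fst_le_one_of_mem_seamColumns {w : FermionTorus 2 L}
    (hw : w ∈ (Finset.univ : Finset (ZMod L)).biUnion fun y =>
      ({FermionTorus.ofTorusSite (![0, y] : TorusSite 2 L), FermionTorus.ofTorusSite (![-1, y] : TorusSite 2 L)} :
        Finset (FermionTorus 2 L))) :
    (FermionTorus.toTorusSite w 0).valMinAbs.natAbs ≤ 1 := by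
  obtain ⟨y, -, hy⟩ := Finset.mem_biUnion.1 hw
  simp only [Finset.mem_insert, Finset.mem_singleton] at hy
  rcases hy with rfl | rfl
  · rw [FermionTorus.toTorusSite_ofTorusSite, Matrix.cons_val_zero, ZMod.valMinAbs_zero]
    exact Nat.zero_le _
  · rw [FermionTorus.toTorusSite_ofTorusSite, Matrix.cons_val_zero]
    exact natAbs_valMinAbs_neg_one_le L

end Coordinate

/-! ### §3 The closed-form leakage bound -/

section Torus

variable (L : ℕ) [NeZero L]

set_option synthInstance.maxSize 1024 in
/-- **Closed-form leakage bound for the seam dynamics** (input (ii) of the QBP localisation, Capel–Moscolari–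
Teufel–Wessel Thm. 14, for the flux seam of the Hubbard torus).  Keep the Hubbard terms supported in the collar
`X_r = {x : |x₁|_∘ ≤ r}` of the seam (`r ≥ 2`); then for `H = hubbardTorusTT'Flux L 0 U 0`, `V = seamTwist L θ`,
`s ∈ [0, 1]` and every `t`,
`‖τ^{H + sV}_t(V) − τ^{H_{T_r} + sV}_t(V)‖ ≤ N (2‖V‖ (N (2J²|t| e^{2eJ·22|t| − (r − 2)}))) |t|`,
`J = 2 + |U| + 2|θ|`, `N = |HubbardIdx ⊕ (ZMod L × Fin 2)|`: the levels are
`δ_Z(x) = max_{z ∈ supp Z} (|z₁|_∘ − |x₁|_∘ − 1)₊`. [cite: CapelEtAl2023, Thm. 14] -/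
theorem norm_seamDynamics_sub_collar_le_of_radius (U θ : ℝ) {s : ℝ} (hs : s ∈ Set.Icc (0 : ℝ) 1) {r : ℕ}
    (hr : 2 ≤ r) (t : ℝ) :
    ‖heisenbergEvolution (hubbardTorusTT'Flux L 0 U 0 + (s : ℂ) • seamTwist L θ) t (seamTwist L θ) -
        heisenbergEvolution
          (∑ Z ∈ Finset.univ.filter (fun Z : HubbardIdx (fermionTorusGraph 2 L) =>
              hubbardTermSupp (fermionTorusGraph 2 L) Z ⊆
                Finset.univ.filter (fun x : FermionTorus 2 L => (FermionTorus.toTorusSite x 0).valMinAbs.natAbs ≤ r)),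
            hubbardTermOp (fermionTorusGraph 2 L) 1 U 0 Z + (s : ℂ) • seamTwist L θ) t (seamTwist L θ)‖ ≤
      (Fintype.card (HubbardIdx (fermionTorusGraph 2 L) ⊕ (ZMod L × Fin 2)) *
        (2 * ‖seamTwist L θ‖ *
          (Fintype.card (HubbardIdx (fermionTorusGraph 2 L) ⊕ (ZMod L × Fin 2)) *
            (2 * (2 + |U| + 2 * |θ|) * (2 + |U| + 2 * |θ|) * |t| *
              Real.exp (Real.exp 1 * (2 * (2 + |U| + 2 * |θ|) * ((22 : ℕ) : ℝ)) * |t| - ((r - 2 : ℕ) : ℝ)))))) *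
        |t| := by
  -- supports of the seam-augmented family have diameter `≤ 1`
  have hadj' : ∀ (Z : HubbardIdx (fermionTorusGraph 2 L) ⊕ (ZMod L × Fin 2)) {z w : FermionTorus 2 L},
      z ∈ Sum.elim (hubbardTermSupp (fermionTorusGraph 2 L))
        (fun p => ({FermionTorus.ofTorusSite (![0, p.1] : TorusSite 2 L),
          FermionTorus.ofTorusSite (![-1, p.1] : TorusSite 2 L)} : Finset (FermionTorus 2 L))) Z →
      w ∈ Sum.elim (hubbardTermSupp (fermionTorusGraph 2 L))
        (fun p => ({FermionTorus.ofTorusSite (![0, p.1] : TorusSite 2 L),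
          FermionTorus.ofTorusSite (![-1, p.1] : TorusSite 2 L)} : Finset (FermionTorus 2 L))) Z →
      z = w ∨ (fermionTorusGraph 2 L).Adj z w := by
    intro Z z w hz hw
    cases Z with
    | inl Z => exact eq_or_adj_of_mem_hubbardTermSupp _ hz hw
    | inr p => exact eq_or_adj_of_mem_seamSites L p.1 hz hw
  -- a term outside `T_r` has a site of circular size `> r`
  have hout : ∀ Z : HubbardIdx (fermionTorusGraph 2 L),
      Z ∉ Finset.univ.filter (fun Z : HubbardIdx (fermionTorusGraph 2 L) =>
        hubbardTermSupp (fermionTorusGraph 2 L) Z ⊆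
          Finset.univ.filter (fun x : FermionTorus 2 L => (FermionTorus.toTorusSite x 0).valMinAbs.natAbs ≤ r)) →
      ∃ u ∈ hubbardTermSupp (fermionTorusGraph 2 L) Z, r < (FermionTorus.toTorusSite u 0).valMinAbs.natAbs := by
    intro Z hZ
    simp only [Finset.mem_filter, Finset.mem_univ, true_and, Finset.not_subset] at hZ
    obtain ⟨u, hu, huX⟩ := hZ
    exact ⟨u, hu, by simpa [Finset.mem_filter] using huX⟩
  refine norm_seamDynamics_sub_collar_le L U θ hs
    (Finset.univ.filter (fun Z : HubbardIdx (fermionTorusGraph 2 L) =>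
      hubbardTermSupp (fermionTorusGraph 2 L) Z ⊆
        Finset.univ.filter (fun x : FermionTorus 2 L => (FermionTorus.toTorusSite x 0).valMinAbs.natAbs ≤ r)))
    (X := Finset.univ.filter (fun x : FermionTorus 2 L => (FermionTorus.toTorusSite x 0).valMinAbs.natAbs ≤ r))
    ?_ ?_
    (fun Z x => (Sum.elim (hubbardTermSupp (fermionTorusGraph 2 L))
      (fun p => ({FermionTorus.ofTorusSite (![0, p.1] : TorusSite 2 L),
        FermionTorus.ofTorusSite (![-1, p.1] : TorusSite 2 L)} : Finset (FermionTorus 2 L))) Z).sup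
      fun z => (FermionTorus.toTorusSite z 0).valMinAbs.natAbs - (FermionTorus.toTorusSite x 0).valMinAbs.natAbs - 1)
    ?_ ?_ ?_ (r - 2) ?_ t
  · -- the kept terms live in the collar
    intro Z hZ
    exact (Finset.mem_filter.1 hZ).2
  · -- the seam columns lie in the collar
    intro y
    refine ⟨Finset.mem_filter.2 ⟨Finset.mem_univ _, ?_⟩, Finset.mem_filter.2 ⟨Finset.mem_univ _, ?_⟩⟩
    · rw [FermionTorus.toTorusSite_ofTorusSite, Matrix.cons_val_zero, ZMod.valMinAbs_zero]
      exact Nat.zero_le _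
    · rw [FermionTorus.toTorusSite_ofTorusSite, Matrix.cons_val_zero]
      exact (natAbs_valMinAbs_neg_one_le L).trans (by omega)
  · -- the levels vanish on the supports
    intro Z y hy
    refine Nat.le_zero.1 (Finset.sup_le fun z hz => ?_)
    have h := natAbs_valMinAbs_fst_le_of_eq_or_adj L (hadj' Z hz hy)
    exact Nat.le_zero.2 (by omega)
  · -- the levels are `1`-Lipschitz along edges
    intro Z x y hxy
    refine Finset.sup_le fun z hz => ?_
    have h := natAbs_valMinAbs_fst_le_of_adj L hxy.symm
    refine le_trans ?_ (Nat.add_le_add_right (Finset.le_sup (f := fun z =>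
      (FermionTorus.toTorusSite z 0).valMinAbs.natAbs - (FermionTorus.toTorusSite y 0).valMinAbs.natAbs - 1) hz) 1)
    omega
  · -- the boundary terms do not meet the seam columns
    intro Z hZT hZX
    obtain ⟨u, hu, hur⟩ := hout Z hZT
    refine Finset.disjoint_left.2 fun w hw hwS => ?_
    have h1 := natAbs_valMinAbs_fst_le_one_of_mem_seamColumns L hwS
    have h2 := natAbs_valMinAbs_fst_le_of_eq_or_adj L (eq_or_adj_of_mem_hubbardTermSupp _ hu hw)
    omega
  · -- the levels of the boundary terms are `≥ r - 2` near the seam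
    intro Z hZT hZX Z' hZ' z hz
    obtain ⟨u, hu, hur⟩ := hout Z hZT
    obtain ⟨w, hw, hwS⟩ := Finset.not_disjoint_iff.1 hZ'
    have h1 := natAbs_valMinAbs_fst_le_one_of_mem_seamColumns L hwS
    have h2 := natAbs_valMinAbs_fst_le_of_eq_or_adj L (hadj' Z' hz hw)
    refine le_trans ?_ (Finset.le_sup (f := fun z' =>
      (FermionTorus.toTorusSite z' 0).valMinAbs.natAbs - (FermionTorus.toTorusSite z 0).valMinAbs.natAbs - 1) hu)
    omega

end Torus

end Summit.Ventures.CertifiedManyBodySolver.Theorems.TcThermcert1.GaugeQbpFarSeam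

end
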